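import Summits.QuantumFields.YangMills.Theorems.BalabanUVNodesN15CurvedGluingSmoothCutDressedGluedGaugedUN
import Summits.QuantumFields.YangMills.Theorems.BalabanUVNodesN15CurvedGluingSmoothCutDressedGluedGaugedClose
import HarnessLib

/-!
# N15 = NE2, road (c) — PROGRAMME (PC), towards (PC-B): WALK LOCALITY OF FILE 52's GLUED PROPAGATOR OF `Δ_{R_U} + P` (unitary per-cube site gauges) UNDER A CHANGE OF THE GAUGE DATA
# AWAY FROM THE ARGUMENTS — two families `(u_k, U, P)`, `(u♭_k, U♭, P♭)` with equal site gauges off `Far` ⟹ `𝒢 − 𝒢♭ ≤ [C_near + C_far e^{−(ρ₃∕4−σ)d_Z(y)}]e^{−(ρ₃∕4−2σ)d}` (dag-n15-c g27, n15-c∕294)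

Cell `pub-ymgap`, seat `pub-ymgap-dag-n15-c` (generation g27; R134 (a), s1; HUMAN RULING D-0062).  `bears_on: R4∕N15 · K3⁸ SpineGivenEndpointR13SepCoPHV (stmt-QuantumFields-27366)`;
filed `--kind proof --supports stmt-QuantumFields-27366 --as helper` — COUNT-NEUTRAL.  0 `def`, 0 `sorry`.  Imports FILE 52 `…CurvedGluingSmoothCutDressedGluedGaugedUN` (its discharges:
`uN_siteGauge_orthogonal`, `uN_localOp_species_form`, `localOp_eq_cut_add_farDefect`, `hasMaj_cutPert_structural_of_local`, `hasMaj_mulOp_farDefect_smoothCutDressed`,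
`hasMaj_commOp_farDefect_structural`) and n15-c∕293 `…CurvedGluingSmoothCutDressedGluedGaugedClose` (`hasMaj_glueInv_sub_glueInv_smoothCutDressed_localGauges_close`).  Statement and
proof are FILE 52's, doubled in the gauge data; generated from the tree text (gen∕buildW7.py).  Nothing in the tree is modified.

WHY ((PC-B), [B9] (3.95)–(3.96) p.411; Cor. 3.8 p.410).  The per-cube inverse of `Q′G′²Q′ᵀ(U)` compares the knit of `U^{w_□}` (site gauges `𝟙` near `□`) with the flat knit
(`u ≡ 𝟙`, `U ≡ 𝟙`); this file is the species-level comparison, the site level (n15-c∕262's cover) is next.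

HONEST FRAMING ∕ LIMITS.  Algebra of glued inverses; no propagator estimated; [B9] cited for SHAPES ∕ MECHANISM.  NE2⁺ NOT PRINTED, NOT proved; N15 of record untouched; K3⁸ OPEN;
counts UNMOVED.  Restate-immune (no Theses import).
-/

set_option autoImplicit false

noncomputable section
open scoped BigOperators Matrix Matrix.Norms.Frobenius
open Finset

namespace Summit.QuantumFields.YangMills.BalabanUVNodes.N15.CurvedSpecies

open Literature.MathematicalPhysics.QuantumFieldTheory.Balaban1983to89
open Literature.MathematicalPhysics.QuantumFieldTheory.Balaban1983to89.B11SectG (BlockNorm HasMaj RowSum hasMaj_zero)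
open Literature.MathematicalPhysics.QuantumFieldTheory.Balaban1983to89.B6RandomWalk (Triangle254)
open Literature.MathematicalPhysics.QuantumFieldTheory.Balaban1983to89.B6Prop26Gluing (mulOp mulOp_apply ind ind_nonneg ind_le_one)
open Summit.QuantumFields.YangMills.BalabanUVNodes.N15.MatrixSpecies (mmulOp liftBlk liftEquiv liftEquiv_apply liftEquiv_symm_apply coordMat)
open Summit.QuantumFields.YangMills.BalabanUVNodes.N15.BackgroundLayer (fgrad bgrad fgradAdj stack projO blkPair bgPropV covLapM tCoefA tCoefC unstackM projO_none_comp_stack)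
open Summit.QuantumFields.YangMills.BalabanUVNodes.N15.Gluing (commOp lapOp parametrix remainder glueInv)
open Literature.Barriers.QuantumFields (traceForm)

variable {X ι J K : Type} [Fintype X] [DecidableEq X] [Fintype ι] [DecidableEq ι] [Fintype J] [DecidableEq J] [Fintype K] {g : B6.Geometry} (blk : X → g.Site) (τ : J → X ≃ X)
  {σ cr : ℝ} {N : K → (X × ι → ℝ) →ₗ[ℝ] (X × ι → ℝ)} {NL : (X × ι → ℝ) →ₗ[ℝ] (X × ι → ℝ)}
  {χX χtX ψX hX : K → X → ℝ} {Sk : K → Set g.Site} {hb : K → g.Site → ℝ} {β β₁ ct δ : ℝ}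
set_option maxHeartbeats 400000 in
/-- ★★★ **WALK LOCALITY OF THE GLUED PROPAGATOR OF `Δ_{R_U} + P` IN UNITARY PER-CUBE SITE GAUGES, CLOSE NEAR DATA** — FILE 52's hypotheses for ONE set of flat smooth-cut cubes,
cuts, partition, tails and flat nonlocal summand `N_L`, and TWO families of gauge data `(u_k, U, P = N_L − N_V k in cube k's gauge)`, `(u♭_k, U♭, P♭ = N_L − N♭_V k)` with the same letters
(`r_V, R_N, θ_F, ρ_F`; (3.35) on each cube WHERE `χ_k ≠ 0`), `u♭_k = u_k` on the cubes not `Far`, `S_k ⊆ Z` on the far cubes, `8σ ≤ ρ₃` ⟹ the two glued operators differ by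
n15-c∕293's majorant (with FILE 52's letters `θ_F ↦ θ_F·β̄′c_r`, `ε_F ↦ 0` and the closeness radius `R_c ↦ r_V(1 + |J ⊕ J|) + R_N`, the UNWEAKENED cut-perturbation letter):
`[C_near + C_far·e^{−(ρ₃∕4−σ)d_Z(y)}]·e^{−(ρ₃∕4−2σ)d}`.  FILE 52's discharges (site gauges orthogonal, covariance identity, cut-perturbation letter, far-defect rows) for both families, then n15-c∕293. [cite: Balaban1985BackgroundPropagators, (3.34)–(3.35) p.396, Cor. 3.8 p.410, (3.62)–(3.65) pp.402–403, Thm 3.14 pp.426–427 (mechanism); Balaban1984PropagatorsII, (2.91) p.239, (2.133)–(2.136) p.247] -/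
theorem uN_hasMaj_glueInv_sub_glueInv_smoothCutDressed_localGauges_close {m : Type} [Fintype m] [DecidableEq m] (e : Matrix m m ℂ ≃L[ℝ] (ι → ℝ)) {u : K → X → Matrix m m ℂ} {U : J → X → Matrix m m ℂ}
    {P : (X × ι → ℝ) →ₗ[ℝ] (X × ι → ℝ)} {NV : K → (X × ι → ℝ) →ₗ[ℝ] (X × ι → ℝ)} (η : ℝ) (Far : K → Prop) [DecidablePred Far] (Z : Set g.Site) (dZ : g.Site → ℝ) (htri : Triangle254 g) (hd : ∀ a b : g.Site, 0 ≤ g.dist a b) (hd0 : ∀ y : g.Site, g.dist y y = 0) (hsymm : ∀ y y', g.dist y y' = g.dist y' y) (hdZ : ∀ y z, z ∈ Z → dZ y ≤ g.dist y z) (hdZ0 : ∀ y, 0 ≤ dZ y)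
    (hrow : RowSum g σ cr) (hσ : 0 ≤ σ) {ρ₁ ρ₂ ρ₃ ρN ρT δV ε R ε₀ c₁ c₂ θW cN ℓ ω d₁ Nov : ℝ} (hβ : 0 ≤ β) (hβ₁ : 0 ≤ β₁) (hct : 0 ≤ ct) (hR : 0 ≤ R) (hε₀ : 0 ≤ ε₀) (hcr : 0 ≤ cr) (hNov : 0 ≤ Nov) (hσρ : σ ≤ ρ₁) (hρ₁V : ρ₁ ≤ δV)
    (hρ₁G : ρ₁ + σ ≤ δ) (hρ₂ : 0 ≤ ρ₂) (hρ₂₁ : ρ₂ + σ ≤ ρ₁) (hρ₂T : ρ₂ + σ ≤ ρT) (hρ₃ : 0 ≤ ρ₃) (hρ₃₂ : ρ₃ ≤ ρ₂) (hρ₃V : ρ₃ + σ ≤ δV - ε) (hρ₃N : ρ₃ + σ ≤ ρN) (hσρ₃ : 8 * σ ≤ ρ₃)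
    (hε : 0 < ε) (hc₁ : 0 ≤ c₁) (hc₂ : 0 ≤ c₂) (hθW : 0 ≤ θW) (hcN : 0 ≤ cN) (hℓ : 0 ≤ ℓ) (hω : 0 ≤ ω) (hd₁ : 0 ≤ d₁)
    -- per cube: supports, the bump and its insertions (both ways), the input cut-off
    (hSχ : ∀ k x, χX k x ≠ 0 → blk x ∈ Sk k) (hSψ : ∀ k x, ψX k x ≠ 0 → blk x ∈ Sk k) (hχt : ∀ k x, |χtX k x| ≤ 1)
    (hdχt : ∀ k μ p, |fgrad η⁻¹ (liftEquiv (τ μ) ι) (fun p : X × ι => χtX k p.1) p| ≤ ct) (hdχtb : ∀ k μ p, |bgrad η⁻¹ (liftEquiv (τ μ) ι) (fun p : X × ι => χtX k p.1) p| ≤ ct)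
    (hsub : ∀ k, mulOp (fun p : X × ι => χtX k p.1) ∘ₗ mulOp (fun p : X × ι => χX k p.1) = mulOp (fun p : X × ι => χtX k p.1))
    (hχ : ∀ k, mulOp (fun p : X × ι => χX k p.1) ∘ₗ mulOp (fun p : X × ι => χtX k p.1) = mulOp (fun p : X × ι => χtX k p.1))
    (hs : ∀ k μ, mulOp ((fun p : X × ι => χtX k p.1) ∘ (liftEquiv (τ μ) ι)) ∘ₗ mulOp (fun p : X × ι => χX k p.1) = mulOp ((fun p : X × ι => χtX k p.1) ∘ (liftEquiv (τ μ) ι)))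
    (hsb : ∀ k μ, mulOp ((fun p : X × ι => χtX k p.1) ∘ (liftEquiv (τ μ) ι).symm) ∘ₗ mulOp (fun p : X × ι => χX k p.1) = mulOp ((fun p : X × ι => χtX k p.1) ∘ (liftEquiv (τ μ) ι).symm))
    (hdd : ∀ k μ, mulOp (fgrad η⁻¹ (liftEquiv (τ μ) ι) (fun p : X × ι => χtX k p.1)) ∘ₗ mulOp (fun p : X × ι => χX k p.1) = mulOp (fgrad η⁻¹ (liftEquiv (τ μ) ι) (fun p : X × ι => χtX k p.1)))
    (hddb : ∀ k μ, mulOp (bgrad η⁻¹ (liftEquiv (τ μ) ι) (fun p : X × ι => χtX k p.1)) ∘ₗ mulOp (fun p : X × ι => χX k p.1) = mulOp (bgrad η⁻¹ (liftEquiv (τ μ) ι) (fun p : X × ι => χtX k p.1)))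
    (hs' : ∀ k μ, mulOp (fun p : X × ι => χX k p.1) ∘ₗ mulOp ((fun p : X × ι => χtX k p.1) ∘ (liftEquiv (τ μ) ι)) = mulOp ((fun p : X × ι => χtX k p.1) ∘ (liftEquiv (τ μ) ι)))
    (hsb' : ∀ k μ, mulOp (fun p : X × ι => χX k p.1) ∘ₗ mulOp ((fun p : X × ι => χtX k p.1) ∘ (liftEquiv (τ μ) ι).symm) = mulOp ((fun p : X × ι => χtX k p.1) ∘ (liftEquiv (τ μ) ι).symm))
    (hdd' : ∀ k μ, mulOp (fun p : X × ι => χX k p.1) ∘ₗ mulOp (fgrad η⁻¹ (liftEquiv (τ μ) ι) (fun p : X × ι => χtX k p.1)) = mulOp (fgrad η⁻¹ (liftEquiv (τ μ) ι) (fun p : X × ι => χtX k p.1)))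
    (hddb' : ∀ k μ, mulOp (fun p : X × ι => χX k p.1) ∘ₗ mulOp (bgrad η⁻¹ (liftEquiv (τ μ) ι) (fun p : X × ι => χtX k p.1)) = mulOp (bgrad η⁻¹ (liftEquiv (τ μ) ι) (fun p : X × ι => χtX k p.1)))
    (hNψ : ∀ k, N k ∘ₗ mulOp (fun p : X × ι => ψX k p.1) = N k)
    -- per cube: FILE 63's cut rows
    (hcut : ∀ k, HasMaj (BlockNorm.ofBlocks g (liftBlk blk ι)) (BlockNorm.ofBlocks g (liftBlk blk ι)) (mulOp (fun p : X × ι => χX k p.1) ∘ₗ N k) (fun y y' => ind (Sk k) y * ind (Sk k) y' * (β * Real.exp (-(δ * g.dist y y')))))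
    (hcutF : ∀ k μ, HasMaj (BlockNorm.ofBlocks g (liftBlk blk ι)) (BlockNorm.ofBlocks g (liftBlk blk ι)) (mulOp (fun p : X × ι => χX k p.1) ∘ₗ (fgrad η⁻¹ (liftEquiv (τ μ) ι) ∘ₗ N k)) (fun y y' => ind (Sk k) y * ind (Sk k) y' * (β₁ * Real.exp (-(δ * g.dist y y')))))
    (hcutB : ∀ k μ, HasMaj (BlockNorm.ofBlocks g (liftBlk blk ι)) (BlockNorm.ofBlocks g (liftBlk blk ι)) (mulOp (fun p : X × ι => χX k p.1) ∘ₗ (bgrad η⁻¹ (liftEquiv (τ μ) ι) ∘ₗ N k)) (fun y y' => ind (Sk k) y * ind (Sk k) y' * (β₁ * Real.exp (-(δ * g.dist y y')))))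
    -- per cube: the partition (`|h| ≤ 1`, `Σh² = 1`, supported in the cut: `M_hM_χ = M_h`, letters `c₁, c₂`, block reading `hb` with `ℓ, ω`), one-step block distance `d₁`, overlap `N_ov`
    (hhabs : ∀ k x, |hX k x| ≤ 1) (hhcut : ∀ k, mulOp (fun p : X × ι => hX k p.1) ∘ₗ mulOp (fun p : X × ι => χX k p.1) = mulOp (fun p : X × ι => hX k p.1))
    (hh1 : ∀ k μ p, |fgrad η⁻¹ (liftEquiv (τ μ) ι) (fun p : X × ι => hX k p.1) p| ≤ c₁) (hh1b : ∀ k μ p, |bgrad η⁻¹ (liftEquiv (τ μ) ι) (fun p : X × ι => hX k p.1) p| ≤ c₁) (hh2 : ∀ k μ p, |fgradAdj η⁻¹ (liftEquiv (τ μ) ι) (fgrad η⁻¹ (liftEquiv (τ μ) ι) (fun p : X × ι => hX k p.1)) p| ≤ c₂)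
    (hLip : ∀ k y y', |hb k y - hb k y'| ≤ ℓ * g.dist y y') (hrh : ∀ k (p : X × ι), |hX k p.1 - hb k (liftBlk blk ι p)| ≤ ω) (hstep : ∀ μ x, g.dist (blk (τ μ x)) (blk x) ≤ d₁)
    (hN : ∀ a, ∑ k, ind (Sk k) a ≤ Nov)
    -- per cube: the tail row (dag-n15-a's images geometry ∕ FILE 68's far sandwich)
    (hT : ∀ k, HasMaj (BlockNorm.ofBlocks g (liftBlk blk ι)) (BlockNorm.ofBlocks g (liftBlk blk ι)) ((-(mulOp (fun p : X × ι => hX k p.1) ∘ₗ NL ∘ₗ mulOp (1 - fun p : X × ι => χtX k p.1))) ∘ₗ N k) (fun y y' => ind (Sk k) y * ind (Sk k) y' * (ε₀ * Real.exp (-(ρT * g.dist y y')))))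
    (hq : (β + (β₁ + ct * β)) * (R * cr) * cr < 1)
    (hKN : ∀ k, HasMaj (BlockNorm.ofBlocks g (liftBlk blk ι)) (BlockNorm.ofBlocks g (liftBlk blk ι)) (commOp NL (fun p : X × ι => hX k p.1)) (fun y y' => cN * Real.exp (-(ρN * g.dist y y'))))
    -- THE GAUGE GROUP OF RECORD: trace-form coordinates `e` of `𝔤 = 𝔲(m)`, unitary per-cube site gauges `u_k`, unitary bond variables `U`, Bałaban's nonlocal summand `P` read in cube `k`'s
    -- gauge as the flat `N_L` minus a per-cube nonlocal perturbation `N_V k`; the species of the transformed bond variables SMALL WHERE `χ_k ≠ 0` ((3.35) on the cube); letters of `N_V k`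
    (he : ∀ A B : Matrix m m ℂ, traceForm A B = e A ⬝ᵥ e B) (hu : ∀ k x, (u k x)ᴴ * u k x = 1) {rV RN θF ρF : ℝ} (hrV : 0 ≤ rV) (hRN : 0 ≤ RN) (hθF : 0 ≤ θF) (hρF : ρ₃ + σ ≤ ρF)
    (hRle : rV * (1 + Fintype.card (J ⊕ J)) + RN ≤ R)
    (hP : ∀ k, mmulOp (fun x => coordMat e (ContinuousLinearMap.mulLeftRight ℝ (Matrix m m ℂ) (u k x) (u k x)ᴴ)) ∘ₗ P ∘ₗ mmulOp (fun x => (coordMat e (ContinuousLinearMap.mulLeftRight ℝ (Matrix m m ℂ) (u k x) (u k x)ᴴ))ᵀ) = NL - NV k)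
    (hχ1 : ∀ k x, |χX k x| ≤ 1) (hψχ : ∀ k, mulOp (fun p : X × ι => ψX k p.1) ∘ₗ mulOp (fun p : X × ι => χX k p.1) = mulOp (fun p : X × ι => χX k p.1))
    (hCloc : ∀ k x, χX k x ≠ 0 → ∀ i, ∑ j, |tCoefC η (gaugePair τ fun μ x => coordMat e (ContinuousLinearMap.mulLeftRight ℝ (Matrix m m ℂ) (u k x * U μ x * (u k (τ μ x))ᴴ) (u k x * U μ x * (u k (τ μ x))ᴴ)ᴴ)) x i j| ≤ rV)
    (hAloc : ∀ k j' x, χX k x ≠ 0 → ∀ i, ∑ j, |tCoefA η (gaugePair τ fun μ x => coordMat e (ContinuousLinearMap.mulLeftRight ℝ (Matrix m m ℂ) (u k x * U μ x * (u k (τ μ x))ᴴ) (u k x * U μ x * (u k (τ μ x))ᴴ)ᴴ)) j' x i j| ≤ rV)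
    (hNVcut : ∀ k, HasMaj (BlockNorm.ofBlocks g (liftBlk blk ι)) (BlockNorm.ofBlocks g (liftBlk blk ι)) (mulOp (fun p : X × ι => ψX k p.1) ∘ₗ NV k ∘ₗ mulOp (fun p : X × ι => χX k p.1)) (fun y y' => RN * Real.exp (-(δV * g.dist y y'))))
    (hfarN : ∀ k, HasMaj (BlockNorm.ofBlocks g (liftBlk blk ι)) (BlockNorm.ofBlocks g (liftBlk blk ι)) ((LinearMap.id - mulOp (fun p : X × ι => ψX k p.1)) ∘ₗ NV k ∘ₗ mulOp (fun p : X × ι => χX k p.1)) (fun y y' => θF * Real.exp (-(ρF * g.dist y y'))))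
    -- supports of the partition inside `ψ_k` and `χ_k` (with shifts and differences)
    (hhψ : ∀ k, mulOp (fun p : X × ι => hX k p.1) ∘ₗ mulOp (fun p : X × ι => ψX k p.1) = mulOp (fun p : X × ι => hX k p.1)) (hχh : ∀ k, mulOp (fun p : X × ι => χX k p.1) ∘ₗ mulOp (fun p : X × ι => hX k p.1) = mulOp (fun p : X × ι => hX k p.1))
    (hhs' : ∀ k μ, mulOp (fun p : X × ι => χX k p.1) ∘ₗ mulOp ((fun p : X × ι => hX k p.1) ∘ (liftEquiv (τ μ) ι)) = mulOp ((fun p : X × ι => hX k p.1) ∘ (liftEquiv (τ μ) ι)))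
    (hhsb' : ∀ k μ, mulOp (fun p : X × ι => χX k p.1) ∘ₗ mulOp ((fun p : X × ι => hX k p.1) ∘ (liftEquiv (τ μ) ι).symm) = mulOp ((fun p : X × ι => hX k p.1) ∘ (liftEquiv (τ μ) ι).symm))
    (hhdd' : ∀ k μ, mulOp (fun p : X × ι => χX k p.1) ∘ₗ mulOp (fgrad η⁻¹ (liftEquiv (τ μ) ι) (fun p : X × ι => hX k p.1)) = mulOp (fgrad η⁻¹ (liftEquiv (τ μ) ι) (fun p : X × ι => hX k p.1)))
    (hhddb' : ∀ k μ, mulOp (fun p : X × ι => χX k p.1) ∘ₗ mulOp (bgrad η⁻¹ (liftEquiv (τ μ) ι) (fun p : X × ι => hX k p.1)) = mulOp (bgrad η⁻¹ (liftEquiv (τ μ) ι) (fun p : X × ι => hX k p.1)))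
    (hq' : Nov * ((Fintype.card ι : ℝ) ^ 2 * ((((Fintype.card J : ℝ) * (c₂ * ((β + (β₁ + ct * β)) * (1 - (β + (β₁ + ct * β)) * (R * cr) * cr)⁻¹) + 2 * (c₁ * ((β + (β₁ + ct * β)) * (1 - (β + (β₁ + ct * β)) * (R * cr) * cr)⁻¹))) + θW + cN * ((β + (β₁ + ct * β)) * (1 - (β + (β₁ + ct * β)) * (R * cr) * cr)⁻¹) * cr)
          + ((ℓ * (Real.exp 1 * ε)⁻¹ + 2 * (ω + ℓ * d₁)) * R * ((β + (β₁ + ct * β)) * (1 - (β + (β₁ + ct * β)) * (R * cr) * cr)⁻¹) * cr + R * c₁ * ((β + (β₁ + ct * β)) * (1 - (β + (β₁ + ct * β)) * (R * cr) * cr)⁻¹) * cr)) + (θF * (1 * ((β + (β₁ + ct * β)) * (1 - (β + (β₁ + ct * β)) * (R * cr) * cr)⁻¹)) * cr)) + (Fintype.card ι : ℝ) ^ 2 * ((ε₀ * (1 - (β + (β₁ + ct * β)) * (R * cr) * cr)⁻¹) + 0)) * cr < 1)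
    -- THE SECOND FAMILY: unitary site gauges `u♭_k`, bond variables `U♭`, nonlocal summand `P♭` read as `N_L − N♭_V k`, the same letters; EQUAL site gauges off `Far`, far regions in `Z`
    {u₂ : K → X → Matrix m m ℂ} {U₂ : J → X → Matrix m m ℂ} {P₂ : (X × ι → ℝ) →ₗ[ℝ] (X × ι → ℝ)} {NV₂ : K → (X × ι → ℝ) →ₗ[ℝ] (X × ι → ℝ)} (hu₂ : ∀ k x, (u₂ k x)ᴴ * u₂ k x = 1)
    (hP₂ : ∀ k, mmulOp (fun x => coordMat e (ContinuousLinearMap.mulLeftRight ℝ (Matrix m m ℂ) (u₂ k x) (u₂ k x)ᴴ)) ∘ₗ P₂ ∘ₗ mmulOp (fun x => (coordMat e (ContinuousLinearMap.mulLeftRight ℝ (Matrix m m ℂ) (u₂ k x) (u₂ k x)ᴴ))ᵀ) = NL - NV₂ k)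
    (hCloc₂ : ∀ k x, χX k x ≠ 0 → ∀ i, ∑ j, |tCoefC η (gaugePair τ fun μ x => coordMat e (ContinuousLinearMap.mulLeftRight ℝ (Matrix m m ℂ) (u₂ k x * U₂ μ x * (u₂ k (τ μ x))ᴴ) (u₂ k x * U₂ μ x * (u₂ k (τ μ x))ᴴ)ᴴ)) x i j| ≤ rV)
    (hAloc₂ : ∀ k j' x, χX k x ≠ 0 → ∀ i, ∑ j, |tCoefA η (gaugePair τ fun μ x => coordMat e (ContinuousLinearMap.mulLeftRight ℝ (Matrix m m ℂ) (u₂ k x * U₂ μ x * (u₂ k (τ μ x))ᴴ) (u₂ k x * U₂ μ x * (u₂ k (τ μ x))ᴴ)ᴴ)) j' x i j| ≤ rV)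
    (hNVcut₂ : ∀ k, HasMaj (BlockNorm.ofBlocks g (liftBlk blk ι)) (BlockNorm.ofBlocks g (liftBlk blk ι)) (mulOp (fun p : X × ι => ψX k p.1) ∘ₗ NV₂ k ∘ₗ mulOp (fun p : X × ι => χX k p.1)) (fun y y' => RN * Real.exp (-(δV * g.dist y y'))))
    (hfarN₂ : ∀ k, HasMaj (BlockNorm.ofBlocks g (liftBlk blk ι)) (BlockNorm.ofBlocks g (liftBlk blk ι)) ((LinearMap.id - mulOp (fun p : X × ι => ψX k p.1)) ∘ₗ NV₂ k ∘ₗ mulOp (fun p : X × ι => χX k p.1)) (fun y y' => θF * Real.exp (-(ρF * g.dist y y'))))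
    (hZ : ∀ k, Far k → Sk k ⊆ Z) (huu : ∀ k, ¬Far k → u₂ k = u k) :
    HasMaj (BlockNorm.ofBlocks g (liftBlk blk ι)) (BlockNorm.ofBlocks g (liftBlk blk ι))
      ((glueInv (parametrix (fun k (p : X × ι) => hX k p.1) (fun k => mmulOp (fun x => (coordMat e (ContinuousLinearMap.mulLeftRight ℝ (Matrix m m ℂ) (u k x) (u k x)ᴴ))ᵀ) ∘ₗ (projO none ∘ₗ bgPropV (stack (mulOp (fun p : X × ι => χtX k p.1) ∘ₗ N k) (fun j => Sum.elim (fun μ => fgrad η⁻¹ (liftEquiv (τ μ) ι)) (fun μ => bgrad η⁻¹ (liftEquiv (τ μ) ι)) j ∘ₗ (mulOp (fun p : X × ι => χtX k p.1) ∘ₗ N k))) (mulOp (fun p : X × ι => ψX k p.1) ∘ₗ (unstackM (tCoefC η (gaugePair τ fun μ x => coordMat e (ContinuousLinearMap.mulLeftRight ℝ (Matrix m m ℂ) (u k x * U μ x * (u k (τ μ x))ᴴ) (u k x * U μ x * (u k (τ μ x))ᴴ)ᴴ)))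
            (tCoefA η (gaugePair τ fun μ x => coordMat e (ContinuousLinearMap.mulLeftRight ℝ (Matrix m m ℂ) (u k x * U μ x * (u k (τ μ x))ᴴ) (u k x * U μ x * (u k (τ μ x))ᴴ)ᴴ))) + NV k ∘ₗ projO none) ∘ₗ mulOp (fun q : (X × ι) × Option (J ⊕ J) => χX k q.1.1))) ∘ₗ mmulOp (fun x => coordMat e (ContinuousLinearMap.mulLeftRight ℝ (Matrix m m ℂ) (u k x) (u k x)ᴴ))))
        (remainder (covLapM τ η (gaugePair τ (fun μ x => coordMat e (ContinuousLinearMap.mulLeftRight ℝ (Matrix m m ℂ) (U μ x) (U μ x)ᴴ))) + P) (fun k (p : X × ι) => hX k p.1) (fun k => mmulOp (fun x => (coordMat e (ContinuousLinearMap.mulLeftRight ℝ (Matrix m m ℂ) (u k x) (u k x)ᴴ))ᵀ) ∘ₗ (projO none ∘ₗ bgPropV (stack (mulOp (fun p : X × ι => χtX k p.1) ∘ₗ N k) (fun j => Sum.elim (fun μ => fgrad η⁻¹ (liftEquiv (τ μ) ι)) (fun μ => bgrad η⁻¹ (liftEquiv (τ μ) ι)) j ∘ₗ (mulOp (fun p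 : X × ι => χtX k p.1) ∘ₗ N k))) (mulOp (fun p : X × ι => ψX k p.1) ∘ₗ (unstackM (tCoefC η (gaugePair τ fun μ x => coordMat e (ContinuousLinearMap.mulLeftRight ℝ (Matrix m m ℂ) (u k x * U μ x * (u k (τ μ x))ᴴ) (u k x * U μ x * (u k (τ μ x))ᴴ)ᴴ)))
            (tCoefA η (gaugePair τ fun μ x => coordMat e (ContinuousLinearMap.mulLeftRight ℝ (Matrix m m ℂ) (u k x * U μ x * (u k (τ μ x))ᴴ) (u k x * U μ x * (u k (τ μ x))ᴴ)ᴴ))) + NV k ∘ₗ projO none) ∘ₗ mulOp (fun q : (X × ι) × Option (J ⊕ J) => χX k q.1.1))) ∘ₗ mmulOp (fun x => coordMat e (ContinuousLinearMap.mulLeftRight ℝ (Matrix m m ℂ) (u k x) (u k x)ᴴ))) -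
          ∑ k, (mmulOp (fun x => (coordMat e (ContinuousLinearMap.mulLeftRight ℝ (Matrix m m ℂ) (u k x) (u k x)ᴴ))ᵀ) ∘ₗ ((((-(mulOp (fun p : X × ι => hX k p.1) ∘ₗ NL ∘ₗ mulOp (1 - fun p : X × ι => χtX k p.1))) ∘ₗ N k) ∘ₗ (LinearMap.id + ((mulOp (fun p : X × ι => ψX k p.1) ∘ₗ (unstackM (tCoefC η (gaugePair τ fun μ x => coordMat e (ContinuousLinearMap.mulLeftRight ℝ (Matrix m m ℂ) (u k x * U μ x * (u k (τ μ x))ᴴ) (u k x * U μ x * (u k (τ μ x))ᴴ)ᴴ)))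
            (tCoefA η (gaugePair τ fun μ x => coordMat e (ContinuousLinearMap.mulLeftRight ℝ (Matrix m m ℂ) (u k x * U μ x * (u k (τ μ x))ᴴ) (u k x * U μ x * (u k (τ μ x))ᴴ)ᴴ))) + NV k ∘ₗ projO none) ∘ₗ mulOp (fun q : (X × ι) × Option (J ⊕ J) => χX k q.1.1)) ∘ₗ stack LinearMap.id (fun j => Sum.elim (fun μ => fgrad η⁻¹ (liftEquiv (τ μ) ι)) (fun μ => bgrad η⁻¹ (liftEquiv (τ μ) ι)) j)) ∘ₗ (projO none ∘ₗ bgPropV (stack (mulOp (fun p : X × ι => χtX k p.1) ∘ₗ N k) (fun j => Sum.elim (fun μ => fgrad η⁻¹ (liftEquiv (τ μ) ι)) (fun μ => bgrad η⁻¹ (liftEquiv (τ μ) ι)) j ∘ₗ (mulOp (fun p : X × ι => χtX k p.1) ∘ₗ N k))) (mulOp (fun p : X × ι => ψX k p.1) ∘ₗ (unstackM (tCoefC η (gaugePair τ fun μ x => coordMat e (ContinuousLinearMap.mulLeftRight ℝ (Matrix m m ℂ) (u k x * U μ x * (u k (τ μ x))ᴴ) (u k x * U μ x * (u k (τ μ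 x))ᴴ)ᴴ)))
            (tCoefA η (gaugePair τ fun μ x => coordMat e (ContinuousLinearMap.mulLeftRight ℝ (Matrix m m ℂ) (u k x * U μ x * (u k (τ μ x))ᴴ) (u k x * U μ x * (u k (τ μ x))ᴴ)ᴴ))) + NV k ∘ₗ projO none) ∘ₗ mulOp (fun q : (X × ι) × Option (J ⊕ J) => χX k q.1.1)))) + mulOp (fun p : X × ι => hX k p.1) ∘ₗ (-(((unstackM (tCoefC η (gaugePair τ fun μ x => coordMat e (ContinuousLinearMap.mulLeftRight ℝ (Matrix m m ℂ) (u k x * U μ x * (u k (τ μ x))ᴴ) (u k x * U μ x * (u k (τ μ x))ᴴ)ᴴ)))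
            (tCoefA η (gaugePair τ fun μ x => coordMat e (ContinuousLinearMap.mulLeftRight ℝ (Matrix m m ℂ) (u k x * U μ x * (u k (τ μ x))ᴴ) (u k x * U μ x * (u k (τ μ x))ᴴ)ᴴ))) + NV k ∘ₗ projO none) - mulOp (fun p : X × ι => ψX k p.1) ∘ₗ (unstackM (tCoefC η (gaugePair τ fun μ x => coordMat e (ContinuousLinearMap.mulLeftRight ℝ (Matrix m m ℂ) (u k x * U μ x * (u k (τ μ x))ᴴ) (u k x * U μ x * (u k (τ μ x))ᴴ)ᴴ)))
            (tCoefA η (gaugePair τ fun μ x => coordMat e (ContinuousLinearMap.mulLeftRight ℝ (Matrix m m ℂ) (u k x * U μ x * (u k (τ μ x))ᴴ) (u k x * U μ x * (u k (τ μ x))ᴴ)ᴴ))) + NV k ∘ₗ projO none) ∘ₗ mulOp (fun q : (X × ι) × Option (J ⊕ J) => χX k q.1.1)) ∘ₗ stack LinearMap.id (fun j => Sum.elim (fun μ => fgrad η⁻¹ (liftEquiv (τ μ) ι)) (fun μ => bgrad η⁻¹ (liftEquiv (τ μ) ι)) j))) ∘ₗ (projO none ∘ₗ bgPropV (stack (mulOp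 (fun p : X × ι => χtX k p.1) ∘ₗ N k) (fun j => Sum.elim (fun μ => fgrad η⁻¹ (liftEquiv (τ μ) ι)) (fun μ => bgrad η⁻¹ (liftEquiv (τ μ) ι)) j ∘ₗ (mulOp (fun p : X × ι => χtX k p.1) ∘ₗ N k))) (mulOp (fun p : X × ι => ψX k p.1) ∘ₗ (unstackM (tCoefC η (gaugePair τ fun μ x => coordMat e (ContinuousLinearMap.mulLeftRight ℝ (Matrix m m ℂ) (u k x * U μ x * (u k (τ μ x))ᴴ) (u k x * U μ x * (u k (τ μ x))ᴴ)ᴴ)))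
            (tCoefA η (gaugePair τ fun μ x => coordMat e (ContinuousLinearMap.mulLeftRight ℝ (Matrix m m ℂ) (u k x * U μ x * (u k (τ μ x))ᴴ) (u k x * U μ x * (u k (τ μ x))ᴴ)ᴴ))) + NV k ∘ₗ projO none) ∘ₗ mulOp (fun q : (X × ι) × Option (J ⊕ J) => χX k q.1.1))))) ∘ₗ mmulOp (fun x => coordMat e (ContinuousLinearMap.mulLeftRight ℝ (Matrix m m ℂ) (u k x) (u k x)ᴴ))) ∘ₗ mulOp (fun p : X × ι => hX k p.1))) -
        (glueInv (parametrix (fun k (p : X × ι) => hX k p.1) (fun k => mmulOp (fun x => (coordMat e (ContinuousLinearMap.mulLeftRight ℝ (Matrix m m ℂ) (u₂ k x) (u₂ k x)ᴴ))ᵀ) ∘ₗ (projO none ∘ₗ bgPropV (stack (mulOp (fun p : X × ι => χtX k p.1) ∘ₗ N k) (fun j => Sum.elim (fun μ => fgrad η⁻¹ (liftEquiv (τ μ) ι)) (fun μ => bgrad η⁻¹ (liftEquiv (τ μ) ι)) j ∘ₗ (mulOp (fun p : X × ι => χtX k p.1) ∘ₗ N k))) (mulOp (fun p : X × ι => ψX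 k p.1) ∘ₗ (unstackM (tCoefC η (gaugePair τ fun μ x => coordMat e (ContinuousLinearMap.mulLeftRight ℝ (Matrix m m ℂ) (u₂ k x * U₂ μ x * (u₂ k (τ μ x))ᴴ) (u₂ k x * U₂ μ x * (u₂ k (τ μ x))ᴴ)ᴴ)))
            (tCoefA η (gaugePair τ fun μ x => coordMat e (ContinuousLinearMap.mulLeftRight ℝ (Matrix m m ℂ) (u₂ k x * U₂ μ x * (u₂ k (τ μ x))ᴴ) (u₂ k x * U₂ μ x * (u₂ k (τ μ x))ᴴ)ᴴ))) + NV₂ k ∘ₗ projO none) ∘ₗ mulOp (fun q : (X × ι) × Option (J ⊕ J) => χX k q.1.1))) ∘ₗ mmulOp (fun x => coordMat e (ContinuousLinearMap.mulLeftRight ℝ (Matrix m m ℂ) (u₂ k x) (u₂ k x)ᴴ))))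
        (remainder (covLapM τ η (gaugePair τ (fun μ x => coordMat e (ContinuousLinearMap.mulLeftRight ℝ (Matrix m m ℂ) (U₂ μ x) (U₂ μ x)ᴴ))) + P₂) (fun k (p : X × ι) => hX k p.1) (fun k => mmulOp (fun x => (coordMat e (ContinuousLinearMap.mulLeftRight ℝ (Matrix m m ℂ) (u₂ k x) (u₂ k x)ᴴ))ᵀ) ∘ₗ (projO none ∘ₗ bgPropV (stack (mulOp (fun p : X × ι => χtX k p.1) ∘ₗ N k) (fun j => Sum.elim (fun μ => fgrad η⁻¹ (liftEquiv (τ μ) ι)) (fun μ => bgrad η⁻¹ (liftEquiv (τ μ) ι)) j ∘ₗ (mulOp (fun p : X × ι => χtX k p.1) ∘ₗ N k))) (mulOp (fun p : X × ι => ψX k p.1) ∘ₗ (unstackM (tCoefC η (gaugePair τ fun μ x => coordMat e (ContinuousLinearMap.mulLeftRight ℝ (Matrix m m ℂ) (u₂ k x * U₂ μ x * (u₂ k (τ μ x))ᴴ) (u₂ k x * U₂ μ x * (u₂ k (τ μ x))ᴴ)ᴴ)))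
            (tCoefA η (gaugePair τ fun μ x => coordMat e (ContinuousLinearMap.mulLeftRight ℝ (Matrix m m ℂ) (u₂ k x * U₂ μ x * (u₂ k (τ μ x))ᴴ) (u₂ k x * U₂ μ x * (u₂ k (τ μ x))ᴴ)ᴴ))) + NV₂ k ∘ₗ projO none) ∘ₗ mulOp (fun q : (X × ι) × Option (J ⊕ J) => χX k q.1.1))) ∘ₗ mmulOp (fun x => coordMat e (ContinuousLinearMap.mulLeftRight ℝ (Matrix m m ℂ) (u₂ k x) (u₂ k x)ᴴ))) -
          ∑ k, (mmulOp (fun x => (coordMat e (ContinuousLinearMap.mulLeftRight ℝ (Matrix m m ℂ) (u₂ k x) (u₂ k x)ᴴ))ᵀ) ∘ₗ ((((-(mulOp (fun p : X × ι => hX k p.1) ∘ₗ NL ∘ₗ mulOp (1 - fun p : X × ι => χtX k p.1))) ∘ₗ N k) ∘ₗ (LinearMap.id + ((mulOp (fun p : X × ι => ψX k p.1) ∘ₗ (unstackM (tCoefC η (gaugePair τ fun μ x => coordMat e (ContinuousLinearMap.mulLeftRight ℝ (Matrix m m ℂ) (u₂ k x * U₂ μ x * (u₂ k (τ μ x))ᴴ)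 (u₂ k x * U₂ μ x * (u₂ k (τ μ x))ᴴ)ᴴ)))
            (tCoefA η (gaugePair τ fun μ x => coordMat e (ContinuousLinearMap.mulLeftRight ℝ (Matrix m m ℂ) (u₂ k x * U₂ μ x * (u₂ k (τ μ x))ᴴ) (u₂ k x * U₂ μ x * (u₂ k (τ μ x))ᴴ)ᴴ))) + NV₂ k ∘ₗ projO none) ∘ₗ mulOp (fun q : (X × ι) × Option (J ⊕ J) => χX k q.1.1)) ∘ₗ stack LinearMap.id (fun j => Sum.elim (fun μ => fgrad η⁻¹ (liftEquiv (τ μ) ι)) (fun μ => bgrad η⁻¹ (liftEquiv (τ μ) ι)) j)) ∘ₗ (projO none ∘ₗ bgPropV (stack (mulOp (fun p : X × ι => χtX k p.1) ∘ₗ N k) (fun j => Sum.elim (fun μ => fgrad η⁻¹ (liftEquiv (τ μ) ι)) (fun μ => bgrad η⁻¹ (liftEquiv (τ μ) ι)) j ∘ₗ (mulOp (fun p : X × ι => χtX k p.1) ∘ₗ N k))) (mulOp (fun p : X × ι => ψX k p.1) ∘ₗ (unstackM (tCoefC η (gaugePair τ fun μ x => coordMat e (ContinuousLinearMap.mulLeftRight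 ℝ (Matrix m m ℂ) (u₂ k x * U₂ μ x * (u₂ k (τ μ x))ᴴ) (u₂ k x * U₂ μ x * (u₂ k (τ μ x))ᴴ)ᴴ)))
            (tCoefA η (gaugePair τ fun μ x => coordMat e (ContinuousLinearMap.mulLeftRight ℝ (Matrix m m ℂ) (u₂ k x * U₂ μ x * (u₂ k (τ μ x))ᴴ) (u₂ k x * U₂ μ x * (u₂ k (τ μ x))ᴴ)ᴴ))) + NV₂ k ∘ₗ projO none) ∘ₗ mulOp (fun q : (X × ι) × Option (J ⊕ J) => χX k q.1.1)))) + mulOp (fun p : X × ι => hX k p.1) ∘ₗ (-(((unstackM (tCoefC η (gaugePair τ fun μ x => coordMat e (ContinuousLinearMap.mulLeftRight ℝ (Matrix m m ℂ) (u₂ k x * U₂ μ x * (u₂ k (τ μ x))ᴴ) (u₂ k x * U₂ μ x * (u₂ k (τ μ x))ᴴ)ᴴ)))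
            (tCoefA η (gaugePair τ fun μ x => coordMat e (ContinuousLinearMap.mulLeftRight ℝ (Matrix m m ℂ) (u₂ k x * U₂ μ x * (u₂ k (τ μ x))ᴴ) (u₂ k x * U₂ μ x * (u₂ k (τ μ x))ᴴ)ᴴ))) + NV₂ k ∘ₗ projO none) - mulOp (fun p : X × ι => ψX k p.1) ∘ₗ (unstackM (tCoefC η (gaugePair τ fun μ x => coordMat e (ContinuousLinearMap.mulLeftRight ℝ (Matrix m m ℂ) (u₂ k x * U₂ μ x * (u₂ k (τ μ x))ᴴ) (u₂ k x * U₂ μ x * (u₂ k (τ μ x))ᴴ)ᴴ)))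
            (tCoefA η (gaugePair τ fun μ x => coordMat e (ContinuousLinearMap.mulLeftRight ℝ (Matrix m m ℂ) (u₂ k x * U₂ μ x * (u₂ k (τ μ x))ᴴ) (u₂ k x * U₂ μ x * (u₂ k (τ μ x))ᴴ)ᴴ))) + NV₂ k ∘ₗ projO none) ∘ₗ mulOp (fun q : (X × ι) × Option (J ⊕ J) => χX k q.1.1)) ∘ₗ stack LinearMap.id (fun j => Sum.elim (fun μ => fgrad η⁻¹ (liftEquiv (τ μ) ι)) (fun μ => bgrad η⁻¹ (liftEquiv (τ μ) ι)) j))) ∘ₗ (projO none ∘ₗ bgPropV (stack (mulOp (fun p : X × ι => χtX k p.1) ∘ₗ N k) (fun j => Sum.elim (fun μ => fgrad η⁻¹ (liftEquiv (τ μ) ι)) (fun μ => bgrad η⁻¹ (liftEquiv (τ μ) ι)) j ∘ₗ (mulOp (fun p : X × ι => χtX k p.1) ∘ₗ N k))) (mulOp (fun p : X × ι => ψX k p.1) ∘ₗ (unstackM (tCoefC η (gaugePair τ fun μ x => coordMat e (ContinuousLinearMap.mulLeftRight ℝ (Matrix m m ℂ) (u₂ k x * U₂ μ x * (u₂ k (τ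 μ x))ᴴ) (u₂ k x * U₂ μ x * (u₂ k (τ μ x))ᴴ)ᴴ)))
            (tCoefA η (gaugePair τ fun μ x => coordMat e (ContinuousLinearMap.mulLeftRight ℝ (Matrix m m ℂ) (u₂ k x * U₂ μ x * (u₂ k (τ μ x))ᴴ) (u₂ k x * U₂ μ x * (u₂ k (τ μ x))ᴴ)ᴴ))) + NV₂ k ∘ₗ projO none) ∘ₗ mulOp (fun q : (X × ι) × Option (J ⊕ J) => χX k q.1.1))))) ∘ₗ mmulOp (fun x => coordMat e (ContinuousLinearMap.mulLeftRight ℝ (Matrix m m ℂ) (u₂ k x) (u₂ k x)ᴴ))) ∘ₗ mulOp (fun p : X × ι => hX k p.1))))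
      (fun y y' => ((Nov * ((Fintype.card ι : ℝ) ^ 2 * (2 * ((β + (β₁ + ct * β)) * ((rV * (1 + Fintype.card (J ⊕ J)) + RN) * ((β + (β₁ + ct * β)) * (1 - (β + (β₁ + ct * β)) * (R * cr) * cr)⁻¹) * cr) * cr))) + Nov * ((Fintype.card ι : ℝ) ^ 2 * ((β + (β₁ + ct * β)) * (1 - (β + (β₁ + ct * β)) * (R * cr) * cr)⁻¹)) * ((1 - Nov * ((Fintype.card ι : ℝ) ^ 2 * ((((Fintype.card J : ℝ) * (c₂ * ((β + (β₁ + ct * β)) * (1 - (β + (β₁ + ct * β)) * (R * cr) * cr)⁻¹) + 2 * (c₁ * ((β + (β₁ + ct * β)) * (1 - (β + (β₁ + ct * β)) * (R * cr) * cr)⁻¹))) + θW + cN * ((β + (β₁ + ct * β)) * (1 - (β + (β₁ + ct * β)) * (R * cr) * cr)⁻¹) * cr) + ((ℓ * (Real.exp 1 * ε)⁻¹ + 2 * (ω + ℓ * d₁)) * R * ((β + (β₁ + ct * β)) * (1 - (β + (β₁ + ct * β)) * (R * cr) * cr)⁻¹) * cr + R * c₁ * ((β + (β₁ + ct * β)) *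 (1 - (β + (β₁ + ct * β)) * (R * cr) * cr)⁻¹) * cr)) + (θF * (1 * ((β + (β₁ + ct * β)) * (1 - (β + (β₁ + ct * β)) * (R * cr) * cr)⁻¹)) * cr)) + (Fintype.card ι : ℝ) ^ 2 * ((ε₀ * (1 - (β + (β₁ + ct * β)) * (R * cr) * cr)⁻¹) + 0)) * cr)⁻¹ * cr) *
            (Nov * ((Fintype.card ι : ℝ) ^ 2 * (2 * ((((Fintype.card J : ℝ) * (c₂ * ((β + (β₁ + ct * β)) * (1 - (β + (β₁ + ct * β)) * (R * cr) * cr)⁻¹) + 2 * (c₁ * ((β + (β₁ + ct * β)) * (1 - (β + (β₁ + ct * β)) * (R * cr) * cr)⁻¹))) + θW + cN * ((β + (β₁ + ct * β)) * (1 - (β + (β₁ + ct * β)) * (R * cr) * cr)⁻¹) * cr) + ((ℓ * (Real.exp 1 * ε)⁻¹ + 2 * (ω + ℓ * d₁)) * R * ((β + (β₁ + ct * β)) * (1 - (β + (β₁ + ct * β)) * (R * cr) * cr)⁻¹) * cr + R * c₁ * ((β + (β₁ + ct * β)) * (1 - (β + (β₁ + ct * β)) * (R * cr) * cr)⁻¹)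 * cr)) + (θF * (1 * ((β + (β₁ + ct * β)) * (1 - (β + (β₁ + ct * β)) * (R * cr) * cr)⁻¹)) * cr))) + (Fintype.card ι : ℝ) ^ 2 * (2 * ((ε₀ * (1 - (β + (β₁ + ct * β)) * (R * cr) * cr)⁻¹) + 0)))) * cr) * ((1 - Nov * ((Fintype.card ι : ℝ) ^ 2 * ((((Fintype.card J : ℝ) * (c₂ * ((β + (β₁ + ct * β)) * (1 - (β + (β₁ + ct * β)) * (R * cr) * cr)⁻¹) + 2 * (c₁ * ((β + (β₁ + ct * β)) * (1 - (β + (β₁ + ct * β)) * (R * cr) * cr)⁻¹))) + θW + cN * ((β + (β₁ + ct * β)) * (1 - (β + (β₁ + ct * β)) * (R * cr) * cr)⁻¹) * cr) + ((ℓ * (Real.exp 1 * ε)⁻¹ + 2 * (ω + ℓ * d₁)) * R * ((β + (β₁ + ct * β)) * (1 - (β + (β₁ + ct * β)) * (R * cr) * cr)⁻¹) * cr + R * c₁ * ((β + (β₁ + ct * β)) * (1 - (β + (β₁ + ct * β)) * (R * cr) * cr)⁻¹) * cr)) + (θF * (1 * ((β + (β₁ + ct * β)) * (1 - (β + (β₁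 + ct * β)) * (R * cr) * cr)⁻¹)) * cr)) + (Fintype.card ι : ℝ) ^ 2 * ((ε₀ * (1 - (β + (β₁ + ct * β)) * (R * cr) * cr)⁻¹) + 0)) * cr)⁻¹ * cr) +
          (Nov * (2 * ((Fintype.card ι : ℝ) ^ 2 * ((β + (β₁ + ct * β)) * (1 - (β + (β₁ + ct * β)) * (R * cr) * cr)⁻¹))) + Nov * ((Fintype.card ι : ℝ) ^ 2 * ((β + (β₁ + ct * β)) * (1 - (β + (β₁ + ct * β)) * (R * cr) * cr)⁻¹)) * ((1 - Nov * ((Fintype.card ι : ℝ) ^ 2 * ((((Fintype.card J : ℝ) * (c₂ * ((β + (β₁ + ct * β)) * (1 - (β + (β₁ + ct * β)) * (R * cr) * cr)⁻¹) + 2 * (c₁ * ((β + (β₁ + ct * β)) * (1 - (β + (β₁ + ct * β)) * (R * cr) * cr)⁻¹))) + θW + cN * ((β + (β₁ + ct * β)) * (1 - (β + (β₁ + ct * β)) * (R * cr) * cr)⁻¹) * cr) + ((ℓ * (Real.exp 1 * ε)⁻¹ + 2 * (ω + ℓ * d₁)) * R * ((β + (β₁ + ct * β)) * (1 - (β + (β₁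 + ct * β)) * (R * cr) * cr)⁻¹) * cr + R * c₁ * ((β + (β₁ + ct * β)) * (1 - (β + (β₁ + ct * β)) * (R * cr) * cr)⁻¹) * cr)) + (θF * (1 * ((β + (β₁ + ct * β)) * (1 - (β + (β₁ + ct * β)) * (R * cr) * cr)⁻¹)) * cr)) + (Fintype.card ι : ℝ) ^ 2 * ((ε₀ * (1 - (β + (β₁ + ct * β)) * (R * cr) * cr)⁻¹) + 0)) * cr)⁻¹ * cr) *
            (Nov * (2 * ((Fintype.card ι : ℝ) ^ 2 * ((ε₀ * (1 - (β + (β₁ + ct * β)) * (R * cr) * cr)⁻¹) + 0))) + Nov * (2 * ((Fintype.card ι : ℝ) ^ 2 * ((((Fintype.card J : ℝ) * (c₂ * ((β + (β₁ + ct * β)) * (1 - (β + (β₁ + ct * β)) * (R * cr) * cr)⁻¹) + 2 * (c₁ * ((β + (β₁ + ct * β)) * (1 - (β + (β₁ + ct * β)) * (R * cr) * cr)⁻¹))) + θW + cN * ((β + (β₁ + ct * β)) * (1 - (β + (β₁ + ct * β)) * (R * cr) * cr)⁻¹) * cr) + ((ℓ * (Real.exp 1 * ε)⁻¹ + 2 *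 (ω + ℓ * d₁)) * R * ((β + (β₁ + ct * β)) * (1 - (β + (β₁ + ct * β)) * (R * cr) * cr)⁻¹) * cr + R * c₁ * ((β + (β₁ + ct * β)) * (1 - (β + (β₁ + ct * β)) * (R * cr) * cr)⁻¹) * cr)) + (θF * (1 * ((β + (β₁ + ct * β)) * (1 - (β + (β₁ + ct * β)) * (R * cr) * cr)⁻¹)) * cr))))) * cr) *
            ((1 - Nov * ((Fintype.card ι : ℝ) ^ 2 * ((((Fintype.card J : ℝ) * (c₂ * ((β + (β₁ + ct * β)) * (1 - (β + (β₁ + ct * β)) * (R * cr) * cr)⁻¹) + 2 * (c₁ * ((β + (β₁ + ct * β)) * (1 - (β + (β₁ + ct * β)) * (R * cr) * cr)⁻¹))) + θW + cN * ((β + (β₁ + ct * β)) * (1 - (β + (β₁ + ct * β)) * (R * cr) * cr)⁻¹) * cr) + ((ℓ * (Real.exp 1 * ε)⁻¹ + 2 * (ω + ℓ * d₁)) * R * ((β + (β₁ + ct * β)) * (1 - (β + (β₁ + ct * β)) * (R * cr) * cr)⁻¹) * cr + R * c₁ * ((β + (β₁ + ct * β)) * (1 - (β + (β₁ + ct * β))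 * (R * cr) * cr)⁻¹) * cr)) + (θF * (1 * ((β + (β₁ + ct * β)) * (1 - (β + (β₁ + ct * β)) * (R * cr) * cr)⁻¹)) * cr)) + (Fintype.card ι : ℝ) ^ 2 * ((ε₀ * (1 - (β + (β₁ + ct * β)) * (R * cr) * cr)⁻¹) + 0)) * cr)⁻¹ * cr) * Real.exp (-((ρ₃ / 4 - σ) * dZ y))) *
        Real.exp (-((ρ₃ / 4 - 2 * σ) * g.dist y y'))) := by
  have hβb : 0 ≤ β + (β₁ + ct * β) := by positivity
  have hqi : 0 ≤ (1 - (β + (β₁ + ct * β)) * (R * cr) * cr)⁻¹ := inv_nonneg.2 (by linarith)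
  have hB : 0 ≤ ((β + (β₁ + ct * β)) * (1 - (β + (β₁ + ct * β)) * (R * cr) * cr)⁻¹) := mul_nonneg hβb hqi
  have hug : ∀ k x, coordMat e (ContinuousLinearMap.mulLeftRight ℝ (Matrix m m ℂ) (u k x) (u k x)ᴴ) * (coordMat e (ContinuousLinearMap.mulLeftRight ℝ (Matrix m m ℂ) (u k x) (u k x)ᴴ))ᵀ = 1 := fun k x => (uN_siteGauge_orthogonal e (u k) he (hu k) x).1
  have hug₂ : ∀ k x, coordMat e (ContinuousLinearMap.mulLeftRight ℝ (Matrix m m ℂ) (u₂ k x) (u₂ k x)ᴴ) * (coordMat e (ContinuousLinearMap.mulLeftRight ℝ (Matrix m m ℂ) (u₂ k x) (u₂ k x)ᴴ))ᵀ = 1 := fun k x => (uN_siteGauge_orthogonal e (u₂ k) he (hu₂ k) x).1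
  have hug' : ∀ k x, (coordMat e (ContinuousLinearMap.mulLeftRight ℝ (Matrix m m ℂ) (u k x) (u k x)ᴴ))ᵀ * coordMat e (ContinuousLinearMap.mulLeftRight ℝ (Matrix m m ℂ) (u k x) (u k x)ᴴ) = 1 := fun k x => (uN_siteGauge_orthogonal e (u k) he (hu k) x).2
  have hug₂' : ∀ k x, (coordMat e (ContinuousLinearMap.mulLeftRight ℝ (Matrix m m ℂ) (u₂ k x) (u₂ k x)ᴴ))ᵀ * coordMat e (ContinuousLinearMap.mulLeftRight ℝ (Matrix m m ℂ) (u₂ k x) (u₂ k x)ᴴ) = 1 := fun k x => (uN_siteGauge_orthogonal e (u₂ k) he (hu₂ k) x).2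
  have hcov : ∀ k, mmulOp (fun x => coordMat e (ContinuousLinearMap.mulLeftRight ℝ (Matrix m m ℂ) (u k x) (u k x)ᴴ)) ∘ₗ (covLapM τ η (gaugePair τ (fun μ x => coordMat e (ContinuousLinearMap.mulLeftRight ℝ (Matrix m m ℂ) (U μ x) (U μ x)ᴴ))) + P) ∘ₗ mmulOp (fun x => (coordMat e (ContinuousLinearMap.mulLeftRight ℝ (Matrix m m ℂ) (u k x) (u k x)ᴴ))ᵀ) =
      (lapOp η⁻¹ (fun μ => liftEquiv (τ μ) ι) 0 + NL - (mulOp (fun p : X × ι => ψX k p.1) ∘ₗ (unstackM (tCoefC η (gaugePair τ fun μ x => coordMat e (ContinuousLinearMap.mulLeftRight ℝ (Matrix m m ℂ) (u k x * U μ x * (u k (τ μ x))ᴴ) (u k x * U μ x * (u k (τ μ x))ᴴ)ᴴ)))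
            (tCoefA η (gaugePair τ fun μ x => coordMat e (ContinuousLinearMap.mulLeftRight ℝ (Matrix m m ℂ) (u k x * U μ x * (u k (τ μ x))ᴴ) (u k x * U μ x * (u k (τ μ x))ᴴ)ᴴ))) + NV k ∘ₗ projO none) ∘ₗ mulOp (fun q : (X × ι) × Option (J ⊕ J) => χX k q.1.1)) ∘ₗ stack LinearMap.id (fun j => Sum.elim (fun μ => fgrad η⁻¹ (liftEquiv (τ μ) ι)) (fun μ => bgrad η⁻¹ (liftEquiv (τ μ) ι)) j)) + (-(((unstackM (tCoefC η (gaugePair τ fun μ x => coordMat e (ContinuousLinearMap.mulLeftRight ℝ (Matrix m m ℂ) (u k x * U μ x * (u k (τ μ x))ᴴ) (u k x * U μ x * (u k (τ μ x))ᴴ)ᴴ)))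
            (tCoefA η (gaugePair τ fun μ x => coordMat e (ContinuousLinearMap.mulLeftRight ℝ (Matrix m m ℂ) (u k x * U μ x * (u k (τ μ x))ᴴ) (u k x * U μ x * (u k (τ μ x))ᴴ)ᴴ))) + NV k ∘ₗ projO none) - mulOp (fun p : X × ι => ψX k p.1) ∘ₗ (unstackM (tCoefC η (gaugePair τ fun μ x => coordMat e (ContinuousLinearMap.mulLeftRight ℝ (Matrix m m ℂ) (u k x * U μ x * (u k (τ μ x))ᴴ) (u k x * U μ x * (u k (τ μ x))ᴴ)ᴴ)))
            (tCoefA η (gaugePair τ fun μ x => coordMat e (ContinuousLinearMap.mulLeftRight ℝ (Matrix m m ℂ) (u k x * U μ x * (u k (τ μ x))ᴴ) (u k x * U μ x * (u k (τ μ x))ᴴ)ᴴ))) + NV k ∘ₗ projO none) ∘ₗ mulOp (fun q : (X × ι) × Option (J ⊕ J) => χX k q.1.1)) ∘ₗ stack LinearMap.id (fun j => Sum.elim (fun μ => fgrad η⁻¹ (liftEquiv (τ μ) ι)) (fun μ => bgrad η⁻¹ (liftEquiv (τ μ) ι)) j))) := fun k => by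
    rw [uN_localOp_species_form e τ (u k) U η he (hu k) P, hP k, ← localOp_eq_cut_add_farDefect, LinearMap.add_comp, LinearMap.comp_assoc, projO_none_comp_stack, LinearMap.comp_id]
    abel
  have hcov₂ : ∀ k, mmulOp (fun x => coordMat e (ContinuousLinearMap.mulLeftRight ℝ (Matrix m m ℂ) (u₂ k x) (u₂ k x)ᴴ)) ∘ₗ (covLapM τ η (gaugePair τ (fun μ x => coordMat e (ContinuousLinearMap.mulLeftRight ℝ (Matrix m m ℂ) (U₂ μ x) (U₂ μ x)ᴴ))) + P₂) ∘ₗ mmulOp (fun x => (coordMat e (ContinuousLinearMap.mulLeftRight ℝ (Matrix m m ℂ) (u₂ k x) (u₂ k x)ᴴ))ᵀ) =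
      (lapOp η⁻¹ (fun μ => liftEquiv (τ μ) ι) 0 + NL - (mulOp (fun p : X × ι => ψX k p.1) ∘ₗ (unstackM (tCoefC η (gaugePair τ fun μ x => coordMat e (ContinuousLinearMap.mulLeftRight ℝ (Matrix m m ℂ) (u₂ k x * U₂ μ x * (u₂ k (τ μ x))ᴴ) (u₂ k x * U₂ μ x * (u₂ k (τ μ x))ᴴ)ᴴ)))
            (tCoefA η (gaugePair τ fun μ x => coordMat e (ContinuousLinearMap.mulLeftRight ℝ (Matrix m m ℂ) (u₂ k x * U₂ μ x * (u₂ k (τ μ x))ᴴ) (u₂ k x * U₂ μ x * (u₂ k (τ μ x))ᴴ)ᴴ))) + NV₂ k ∘ₗ projO none) ∘ₗ mulOp (fun q : (X × ι) × Option (J ⊕ J) => χX k q.1.1)) ∘ₗ stack LinearMap.id (fun j => Sum.elim (fun μ => fgrad η⁻¹ (liftEquiv (τ μ) ι)) (fun μ => bgrad η⁻¹ (liftEquiv (τ μ) ι)) j)) + (-(((unstackM (tCoefC η (gaugePair τ fun μ x => coordMat e (ContinuousLinearMap.mulLeftRight ℝ (Matrix m m ℂ) (u₂ k x * U₂ μ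 x * (u₂ k (τ μ x))ᴴ) (u₂ k x * U₂ μ x * (u₂ k (τ μ x))ᴴ)ᴴ)))
            (tCoefA η (gaugePair τ fun μ x => coordMat e (ContinuousLinearMap.mulLeftRight ℝ (Matrix m m ℂ) (u₂ k x * U₂ μ x * (u₂ k (τ μ x))ᴴ) (u₂ k x * U₂ μ x * (u₂ k (τ μ x))ᴴ)ᴴ))) + NV₂ k ∘ₗ projO none) - mulOp (fun p : X × ι => ψX k p.1) ∘ₗ (unstackM (tCoefC η (gaugePair τ fun μ x => coordMat e (ContinuousLinearMap.mulLeftRight ℝ (Matrix m m ℂ) (u₂ k x * U₂ μ x * (u₂ k (τ μ x))ᴴ) (u₂ k x * U₂ μ x * (u₂ k (τ μ x))ᴴ)ᴴ)))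
            (tCoefA η (gaugePair τ fun μ x => coordMat e (ContinuousLinearMap.mulLeftRight ℝ (Matrix m m ℂ) (u₂ k x * U₂ μ x * (u₂ k (τ μ x))ᴴ) (u₂ k x * U₂ μ x * (u₂ k (τ μ x))ᴴ)ᴴ))) + NV₂ k ∘ₗ projO none) ∘ₗ mulOp (fun q : (X × ι) × Option (J ⊕ J) => χX k q.1.1)) ∘ₗ stack LinearMap.id (fun j => Sum.elim (fun μ => fgrad η⁻¹ (liftEquiv (τ μ) ι)) (fun μ => bgrad η⁻¹ (liftEquiv (τ μ) ι)) j))) := fun k => by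
    rw [uN_localOp_species_form e τ (u₂ k) U₂ η he (hu₂ k) P₂, hP₂ k, ← localOp_eq_cut_add_farDefect, LinearMap.add_comp, LinearMap.comp_assoc, projO_none_comp_stack, LinearMap.comp_id]
    abel
  have hV : ∀ k, HasMaj (BlockNorm.ofBlocks g (blkPair (liftBlk blk ι))) (BlockNorm.ofBlocks g (liftBlk blk ι)) (mulOp (fun p : X × ι => ψX k p.1) ∘ₗ (unstackM (tCoefC η (gaugePair τ fun μ x => coordMat e (ContinuousLinearMap.mulLeftRight ℝ (Matrix m m ℂ) (u k x * U μ x * (u k (τ μ x))ᴴ) (u k x * U μ x * (u k (τ μ x))ᴴ)ᴴ)))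
            (tCoefA η (gaugePair τ fun μ x => coordMat e (ContinuousLinearMap.mulLeftRight ℝ (Matrix m m ℂ) (u k x * U μ x * (u k (τ μ x))ᴴ) (u k x * U μ x * (u k (τ μ x))ᴴ)ᴴ))) + NV k ∘ₗ projO none) ∘ₗ mulOp (fun q : (X × ι) × Option (J ⊕ J) => χX k q.1.1)) (fun y y' => R * Real.exp (-(δV * g.dist y y'))) := fun k =>
    (hasMaj_cutPert_structural_of_local blk hd0 hrV hRN (hχ1 k) (hCloc k) (fun μ x hx => hAloc k μ x hx) (hψχ k) (hNVcut k)).mono fun y y' =>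
      mul_le_mul_of_nonneg_right hRle (Real.exp_nonneg _)
  have hV₂ : ∀ k, HasMaj (BlockNorm.ofBlocks g (blkPair (liftBlk blk ι))) (BlockNorm.ofBlocks g (liftBlk blk ι)) (mulOp (fun p : X × ι => ψX k p.1) ∘ₗ (unstackM (tCoefC η (gaugePair τ fun μ x => coordMat e (ContinuousLinearMap.mulLeftRight ℝ (Matrix m m ℂ) (u₂ k x * U₂ μ x * (u₂ k (τ μ x))ᴴ) (u₂ k x * U₂ μ x * (u₂ k (τ μ x))ᴴ)ᴴ)))
            (tCoefA η (gaugePair τ fun μ x => coordMat e (ContinuousLinearMap.mulLeftRight ℝ (Matrix m m ℂ) (u₂ k x * U₂ μ x * (u₂ k (τ μ x))ᴴ) (u₂ k x * U₂ μ x * (u₂ k (τ μ x))ᴴ)ᴴ))) + NV₂ k ∘ₗ projO none) ∘ₗ mulOp (fun q : (X × ι) × Option (J ⊕ J) => χX k q.1.1)) (fun y y' => R * Real.exp (-(δV * g.dist y y'))) := fun k =>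
    (hasMaj_cutPert_structural_of_local blk hd0 hrV hRN (hχ1 k) (hCloc₂ k) (fun μ x hx => hAloc₂ k μ x hx) (hψχ k) (hNVcut₂ k)).mono fun y y' =>
      mul_le_mul_of_nonneg_right hRle (Real.exp_nonneg _)
  have hW : ∀ k, HasMaj (BlockNorm.ofBlocks g (liftBlk blk ι)) (BlockNorm.ofBlocks g (liftBlk blk ι)) (commOp (0 : (X × ι → ℝ) →ₗ[ℝ] (X × ι → ℝ)) (fun p : X × ι => hX k p.1) ∘ₗ (projO none ∘ₗ bgPropV (stack (mulOp (fun p : X × ι => χtX k p.1) ∘ₗ N k)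
          (fun j => Sum.elim (fun μ => fgrad η⁻¹ (liftEquiv (τ μ) ι)) (fun μ => bgrad η⁻¹ (liftEquiv (τ μ) ι)) j ∘ₗ (mulOp (fun p : X × ι => χtX k p.1) ∘ₗ N k))) (mulOp (fun p : X × ι => ψX k p.1) ∘ₗ (unstackM (tCoefC η (gaugePair τ fun μ x => coordMat e (ContinuousLinearMap.mulLeftRight ℝ (Matrix m m ℂ) (u k x * U μ x * (u k (τ μ x))ᴴ) (u k x * U μ x * (u k (τ μ x))ᴴ)ᴴ)))
            (tCoefA η (gaugePair τ fun μ x => coordMat e (ContinuousLinearMap.mulLeftRight ℝ (Matrix m m ℂ) (u k x * U μ x * (u k (τ μ x))ᴴ) (u k x * U μ x * (u k (τ μ x))ᴴ)ᴴ))) + NV k ∘ₗ projO none) ∘ₗ mulOp (fun q : (X × ι) × Option (J ⊕ J) => χX k q.1.1))))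
      (fun y y' => ind (Sk k) y * ind (Sk k) y' * (θW * Real.exp (-(ρ₂ * g.dist y y')))) := fun k => by
    rw [show commOp (0 : (X × ι → ℝ) →ₗ[ℝ] (X × ι → ℝ)) (fun p : X × ι => hX k p.1) = 0 from by simp [commOp], LinearMap.zero_comp]
    exact (hasMaj_zero _ _).mono fun y y' => mul_nonneg (mul_nonneg (ind_nonneg _ _) (ind_nonneg _ _)) (mul_nonneg hθW (Real.exp_nonneg _))
  have hW₂ : ∀ k, HasMaj (BlockNorm.ofBlocks g (liftBlk blk ι)) (BlockNorm.ofBlocks g (liftBlk blk ι)) (commOp (0 : (X × ι → ℝ) →ₗ[ℝ] (X × ι → ℝ)) (fun p : X × ι => hX k p.1) ∘ₗ (projO none ∘ₗ bgPropV (stack (mulOp (fun p : X × ι => χtX k p.1) ∘ₗ N k)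
          (fun j => Sum.elim (fun μ => fgrad η⁻¹ (liftEquiv (τ μ) ι)) (fun μ => bgrad η⁻¹ (liftEquiv (τ μ) ι)) j ∘ₗ (mulOp (fun p : X × ι => χtX k p.1) ∘ₗ N k))) (mulOp (fun p : X × ι => ψX k p.1) ∘ₗ (unstackM (tCoefC η (gaugePair τ fun μ x => coordMat e (ContinuousLinearMap.mulLeftRight ℝ (Matrix m m ℂ) (u₂ k x * U₂ μ x * (u₂ k (τ μ x))ᴴ) (u₂ k x * U₂ μ x * (u₂ k (τ μ x))ᴴ)ᴴ)))
            (tCoefA η (gaugePair τ fun μ x => coordMat e (ContinuousLinearMap.mulLeftRight ℝ (Matrix m m ℂ) (u₂ k x * U₂ μ x * (u₂ k (τ μ x))ᴴ) (u₂ k x * U₂ μ x * (u₂ k (τ μ x))ᴴ)ᴴ))) + NV₂ k ∘ₗ projO none) ∘ₗ mulOp (fun q : (X × ι) × Option (J ⊕ J) => χX k q.1.1))))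
      (fun y y' => ind (Sk k) y * ind (Sk k) y' * (θW * Real.exp (-(ρ₂ * g.dist y y')))) := fun k => by
    rw [show commOp (0 : (X × ι → ℝ) →ₗ[ℝ] (X × ι → ℝ)) (fun p : X × ι => hX k p.1) = 0 from by simp [commOp], LinearMap.zero_comp]
    exact (hasMaj_zero _ _).mono fun y y' => mul_nonneg (mul_nonneg (ind_nonneg _ _) (ind_nonneg _ _)) (mul_nonneg hθW (Real.exp_nonneg _))
  have hFX := fun k => hasMaj_mulOp_farDefect_smoothCutDressed blk τ η⁻¹ (Vf := (unstackM (tCoefC η (gaugePair τ fun μ x => coordMat e (ContinuousLinearMap.mulLeftRight ℝ (Matrix m m ℂ) (u k x * U μ x * (u k (τ μ x))ᴴ) (u k x * U μ x * (u k (τ μ x))ᴴ)ᴴ)))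
            (tCoefA η (gaugePair τ fun μ x => coordMat e (ContinuousLinearMap.mulLeftRight ℝ (Matrix m m ℂ) (u k x * U μ x * (u k (τ μ x))ᴴ) (u k x * U μ x * (u k (τ μ x))ᴴ)ᴴ))) + NV k ∘ₗ projO none)) htri hd hrow hσ hβ hβ₁ hct hR hcr hσρ hρ₁V hρ₁G hρ₂ hρ₂₁ (hχt k) (hdχt k) (hdχtb k) (hsub k) (hχ k) (hs k)
    (hsb k) (hdd k) (hddb k) (hs' k) (hsb' k) (hdd' k) (hddb' k) (hcut k) (hcutF k) (hcutB k) (hV k) hq (hhψ k) ρ₃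
  have hFX₂ := fun k => hasMaj_mulOp_farDefect_smoothCutDressed blk τ η⁻¹ (Vf := (unstackM (tCoefC η (gaugePair τ fun μ x => coordMat e (ContinuousLinearMap.mulLeftRight ℝ (Matrix m m ℂ) (u₂ k x * U₂ μ x * (u₂ k (τ μ x))ᴴ) (u₂ k x * U₂ μ x * (u₂ k (τ μ x))ᴴ)ᴴ)))
            (tCoefA η (gaugePair τ fun μ x => coordMat e (ContinuousLinearMap.mulLeftRight ℝ (Matrix m m ℂ) (u₂ k x * U₂ μ x * (u₂ k (τ μ x))ᴴ) (u₂ k x * U₂ μ x * (u₂ k (τ μ x))ᴴ)ᴴ))) + NV₂ k ∘ₗ projO none)) htri hd hrow hσ hβ hβ₁ hct hR hcr hσρ hρ₁V hρ₁G hρ₂ hρ₂₁ (hχt k) (hdχt k) (hdχtb k) (hsub k) (hχ k) (hs k)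
    (hsb k) (hdd k) (hddb k) (hs' k) (hsb' k) (hdd' k) (hddb' k) (hcut k) (hcutF k) (hcutB k) (hV₂ k) hq (hhψ k) ρ₃
  have hFK := fun k => hasMaj_commOp_farDefect_structural blk τ η⁻¹ (NV := NV k)
    (Cc := tCoefC η (gaugePair τ fun μ x => coordMat e (ContinuousLinearMap.mulLeftRight ℝ (Matrix m m ℂ) (u k x * U μ x * (u k (τ μ x))ᴴ) (u k x * U μ x * (u k (τ μ x))ᴴ)ᴴ)))
    (Ac := tCoefA η (gaugePair τ fun μ x => coordMat e (ContinuousLinearMap.mulLeftRight ℝ (Matrix m m ℂ) (u k x * U μ x * (u k (τ μ x))ᴴ) (u k x * U μ x * (u k (τ μ x))ᴴ)ᴴ))) htri hd hrow hσ hβ hβ₁ hct hR hcr hσρ hρ₁V hρ₁G hρ₂ hρ₂₁ (hSχ k) (hSψ k) (hχt k) (hdχt k) (hdχtb k) (hsub k) (hχ k) (hs k)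
    (hsb k) (hdd k) (hddb k) (hs' k) (hsb' k) (hdd' k) (hddb' k) (hNψ k) (hcut k) (hcutF k) (hcutB k) (hV k) hq hθF hρ₃ hρ₃₂ hρF (hhabs k) (hhψ k) (hχh k) (hhs' k) (hhsb' k) (hhdd' k)
    (hhddb' k) (hψχ k) (hfarN k)
  have hFK₂ := fun k => hasMaj_commOp_farDefect_structural blk τ η⁻¹ (NV := NV₂ k)
    (Cc := tCoefC η (gaugePair τ fun μ x => coordMat e (ContinuousLinearMap.mulLeftRight ℝ (Matrix m m ℂ) (u₂ k x * U₂ μ x * (u₂ k (τ μ x))ᴴ) (u₂ k x * U₂ μ x * (u₂ k (τ μ x))ᴴ)ᴴ)))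
    (Ac := tCoefA η (gaugePair τ fun μ x => coordMat e (ContinuousLinearMap.mulLeftRight ℝ (Matrix m m ℂ) (u₂ k x * U₂ μ x * (u₂ k (τ μ x))ᴴ) (u₂ k x * U₂ μ x * (u₂ k (τ μ x))ᴴ)ᴴ))) htri hd hrow hσ hβ hβ₁ hct hR hcr hσρ hρ₁V hρ₁G hρ₂ hρ₂₁ (hSχ k) (hSψ k) (hχt k) (hdχt k) (hdχtb k) (hsub k) (hχ k) (hs k)
    (hsb k) (hdd k) (hddb k) (hs' k) (hsb' k) (hdd' k) (hddb' k) (hNψ k) (hcut k) (hcutF k) (hcutB k) (hV₂ k) hq hθF hρ₃ hρ₃₂ hρF (hhabs k) (hhψ k) (hχh k) (hhs' k) (hhsb' k) (hhdd' k)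
    (hhddb' k) (hψχ k) (hfarN₂ k)
  have hθF' : 0 ≤ θF * (1 * ((β + (β₁ + ct * β)) * (1 - (β + (β₁ + ct * β)) * (R * cr) * cr)⁻¹)) * cr := by positivity
  -- the UNWEAKENED cut-perturbation letters (the closeness radius `r_V(1 + |J ⊕ J|) + R_N`)
  have hVc := fun k => hasMaj_cutPert_structural_of_local blk hd0 hrV hRN (hχ1 k) (hCloc k) (fun μ x hx => hAloc k μ x hx) (hψχ k) (hNVcut k)
  have hVc₂ := fun k => hasMaj_cutPert_structural_of_local blk hd0 hrV hRN (hχ1 k) (hCloc₂ k) (fun μ x hx => hAloc₂ k μ x hx) (hψχ k) (hNVcut₂ k)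
  -- off `Far` the site gauges agree
  have hWW : ∀ k, ¬Far k → (fun x => coordMat e (ContinuousLinearMap.mulLeftRight ℝ (Matrix m m ℂ) (u₂ k x) (u₂ k x)ᴴ)) = (fun x => coordMat e (ContinuousLinearMap.mulLeftRight ℝ (Matrix m m ℂ) (u k x) (u k x)ᴴ)) := fun k hk => by
    funext x; rw [huu k hk]
  have hfin := hasMaj_glueInv_sub_glueInv_smoothCutDressed_localGauges_close blk τ η⁻¹ Far Z dZ htri hd hd0 hsymm hdZ hdZ0 hrow hσ hβ hβ₁ hct hR hε₀ hcr hNov hσρ hρ₁V hρ₁G hρ₂ hρ₂₁ hρ₂T hρ₃ hρ₃₂ hρ₃V hρ₃N hσρ₃ hε hc₁ hc₂ hθW hcN hℓ hω hd₁ hSχ hSψ hχt hdχt hdχtb hsub hχ hs hsb hdd hddb hs' hsb' hdd' hddb' hNψ hcut hcutF hcutB hhabs hhcut hh1 hh1b hh2 hLip hrh hstep hN hT hV hq hW hKN hug hug' hθF' (le_refl (0:ℝ)) hcov hFK hFX hq'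
    hV₂ hW₂ hug₂ hug₂' hcov₂ hFK₂ hFX₂ hZ hWW (by positivity) hRle (fun k _ => hVc k) (fun k _ => hVc₂ k)
  exact hfin

end Summit.QuantumFields.YangMills.BalabanUVNodes.N15.CurvedSpecies

end
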